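import Mathlib
import HarnessLib
import Summits.HubbardSuperconductivity.HubbardSuperconductivity.Theorems.KLProgrammeC4aCausticPairLayer

/-!
# Route `KLProgramme` — crux C4a, S3 brick (B4) «(B4)-UMK1», the caustic pair ϑ-layer WITH AN INTEGRABLE REMAINDER (the logarithm of the pre-caustic angle layer),
# and the logarithmic remainder majorised by two inverse square roots

Cell `gate-hubbard-kl`, seat hubbard-kl-k3c3-p3 (g28; row «implicit-function / monotonicity route for μ(n)»).  Located brick for the (C)-closer lane hubbard-kl-c4a-1
(stub (C) `stub_twoLeg_curvature` of `KLRegimeEngineV17F2`, stmt-HubbardSuperconductivity-20437), memo HOME/hubbard-kl-k3c3-p3/U1-CAUSTIC-SUP.md §4 (N2)/(N6).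
`…C4aPreCausticAngleLayer.intervalIntegral_pre_caustic_angle_le` outputs, besides the one-sided size `lo·max(δ₀,lo)^{−3/2}`, a logarithm `log((√cL + √δ₀)/√δ₀)` of the
caustic offset; `…C4aCausticPairLayer.intervalIntegral_caustic_pair_le` has a constant remainder only.  This file:
* §1 **`intervalIntegral_caustic_pair_remainder_le`** — the pair layer with an extra nonnegative interval-integrable remainder `R ϑ` in both the pre-side and the post-side law:
  `∫_{c₁−δ}^{c₂+δ} F ≤ (8A + 4P)/√b + B·(2δ + (c₂ − c₁)) + ∫_{c₁−δ}^{c₂+δ} R` (same proof, the remainder rides along piece by piece);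
* §2 **`log_offset_le_rpow_sum`** — the logarithmic remainder in product-form currency: `0 < b|ϑ−c₁||ϑ−c₂| ≤ |m| ≤ Γ` ⟹
  `log(Γ/|m|) ≤ 2·(Γ/b)^{1/4}·(|ϑ − c₁|^{−1/2} + |ϑ − c₂|^{−1/2})` (`log y ≤ 4y^{1/4}` — `Real.log_le_rpow_div`, cf. `Literature…SegmentWeights.log_le_four_mul_rpow_quarter` — then AM–GM) — two inverse square roots, each integrable across its zero uniformly in
  the gap (`∫ |ϑ − c|^{−1/2} = 2√· ` per side), so the remainder integral is `≤ 16B′(Γ/b)^{1/4}√(c₂ − c₁ + δ)`: `n`-free and θ-uniform through the antipodal-umklapp touch.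
Pure real analysis; nothing about the model; nothing asserts (C), K3 or superconductivity.
References: Salmhofer 1999 §4.5.3 [cite: Salmhofer1999]; FST II CPAM 51 (1998) §3 [cite: FeldmanSalmhoferTrubowitz1998].
-/

noncomputable section

namespace Summit.HubbardSuperconductivity.HubbardSuperconductivity.Theorems.C4a

set_option linter.dupNamespace false -- summit = problem name (single-conjunct summit), D-0017

open Real Set MeasureTheory intervalIntegral

/-! ## §1 The caustic pair layer with an integrable remainder -/

/-- **THE ϑ-LAYER AT A WEAKLY TRANSVERSAL PAIR / DOUBLE ZERO, WITH AN INTEGRABLE REMAINDER.**  As `…C4aCausticPairLayer.intervalIntegral_caustic_pair_le`, but the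
pre-side and post-side laws may carry an extra remainder `R ϑ ≥ 0`, interval-integrable on the window (e.g. `B′·log(Γ/|δ₀(ϑ)|)` majorised by `log_offset_le_rpow_sum`):
`∫_{c₁−δ}^{c₂+δ} F ≤ (8A + 4P)/√b + B·(2δ + (c₂ − c₁)) + ∫_{c₁−δ}^{c₂+δ} R`.  No integrability hypothesis on `F`. -/
theorem intervalIntegral_caustic_pair_remainder_le {F m R : ℝ → ℝ} {c₁ c₂ δ b lo A P B : ℝ} (hc : c₁ ≤ c₂) (hδ : 0 < δ) (hb : 0 < b) (hlo : 0 < lo)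
    (hA : 0 ≤ A) (hP : 0 ≤ P) (hB : 0 ≤ B)
    (hF0 : ∀ ϑ ∈ Icc (c₁ - δ) (c₂ + δ), 0 ≤ F ϑ)
    (hm : ∀ ϑ ∈ Icc (c₁ - δ) (c₂ + δ), b * |ϑ - c₁| * |ϑ - c₂| ≤ |m ϑ|)
    (hR0 : ∀ ϑ ∈ Icc (c₁ - δ) (c₂ + δ), 0 ≤ R ϑ) (hRi : IntervalIntegrable R volume (c₁ - δ) (c₂ + δ))
    (hpre : ∀ ϑ ∈ Icc (c₁ - δ) (c₂ + δ), ϑ < c₁ ∨ c₂ < ϑ →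
      F ϑ ≤ A * (lo * ((max |m ϑ| lo)⁻¹ * (Real.sqrt (max |m ϑ| lo))⁻¹)) + B + R ϑ)
    (hpost : ∀ ϑ ∈ Ioo c₁ c₂, F ϑ ≤ P * (Real.sqrt |m ϑ|)⁻¹ + B + R ϑ) :
    ∫ ϑ in (c₁ - δ)..(c₂ + δ), F ϑ ≤ (8 * A + 4 * P) / Real.sqrt b + B * (2 * δ + (c₂ - c₁)) + ∫ ϑ in (c₁ - δ)..(c₂ + δ), R ϑ := by
  have hsb : 0 < Real.sqrt b := Real.sqrt_pos.2 hb
  have hRint0 : 0 ≤ ∫ ϑ in (c₁ - δ)..(c₂ + δ), R ϑ :=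
    intervalIntegral.integral_nonneg (by linarith) fun ϑ hϑ => hR0 ϑ hϑ
  have hRHS : 0 ≤ (8 * A + 4 * P) / Real.sqrt b + B * (2 * δ + (c₂ - c₁)) + ∫ ϑ in (c₁ - δ)..(c₂ + δ), R ϑ := by
    have : 0 ≤ c₂ - c₁ := sub_nonneg.2 hc
    positivity
  by_cases hint : IntervalIntegrable F volume (c₁ - δ) (c₂ + δ)
  swap
  · rw [intervalIntegral.integral_undef hint]; exact hRHS
  set h : ℝ := (c₂ - c₁) / 2 with hh
  have hh0 : 0 ≤ h := by rw [hh]; linarith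
  set mid : ℝ := c₁ + h with hmid
  have hmid' : mid = c₂ - h := by rw [hmid, hh]; ring
  -- integrability on the four pieces (F and R)
  have hsub : ∀ p q : ℝ, c₁ - δ ≤ p → p ≤ q → q ≤ c₂ + δ → IntervalIntegrable F volume p q ∧ IntervalIntegrable R volume p q := fun p q hp hpq hq =>
    ⟨hint.mono_set (by rw [uIcc_of_le hpq, uIcc_of_le (by linarith : c₁ - δ ≤ c₂ + δ)]; exact Icc_subset_Icc hp hq),
     hRi.mono_set (by rw [uIcc_of_le hpq, uIcc_of_le (by linarith : c₁ - δ ≤ c₂ + δ)]; exact Icc_subset_Icc hp hq)⟩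
  have hi1 := hsub (c₁ - δ) c₁ le_rfl (by linarith) (by linarith)
  have hi2 := hsub c₁ mid (by linarith) (by rw [hmid]; linarith) (by rw [hmid']; linarith)
  have hi3 := hsub mid c₂ (by rw [hmid]; linarith) (by rw [hmid']; linarith) (by linarith)
  have hi4 := hsub c₂ (c₂ + δ) (by linarith) (by linarith) le_rfl
  rw [← integral_add_adjacent_intervals hi1.1 ((hi2.1.trans hi3.1).trans hi4.1), ← integral_add_adjacent_intervals hi2.1 (hi3.1.trans hi4.1),
    ← integral_add_adjacent_intervals hi3.1 hi4.1,
    ← integral_add_adjacent_intervals hi1.2 ((hi2.2.trans hi3.2).trans hi4.2), ← integral_add_adjacent_intervals hi2.2 (hi3.2.trans hi4.2),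
    ← integral_add_adjacent_intervals hi3.2 hi4.2]
  -- the pre-side majorant (distance form) and its integrability
  set gpre : ℝ → ℝ := fun x => A * (8 * lo / (Real.sqrt b * x + Real.sqrt lo) ^ 3) + B with hgpre
  have hq : ∀ x : ℝ, 0 ≤ x → 0 < Real.sqrt b * x + Real.sqrt lo := fun x hx => by
    have : 0 ≤ Real.sqrt b * x := mul_nonneg hsb.le hx
    have := Real.sqrt_pos.2 hlo; linarith
  have hgpre_cont : ContinuousOn gpre (Icc 0 δ) := by
    refine (ContinuousOn.const_mul (ContinuousOn.div continuousOn_const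
      ((continuousOn_const.mul continuousOn_id).add continuousOn_const |>.pow 3) fun x hx => ?_) A).add continuousOn_const
    exact pow_ne_zero 3 (hq x hx.1).ne'
  have hgpre_int : IntervalIntegrable gpre volume 0 δ := by
    rw [intervalIntegrable_iff_integrableOn_Icc_of_le hδ.le]
    exact hgpre_cont.integrableOn_compact isCompact_Icc
  have hgpre_val : ∫ x in (0 : ℝ)..δ, gpre x ≤ A * (4 / Real.sqrt b) + B * δ := by
    have hi : IntervalIntegrable (fun x : ℝ => 8 * lo / (Real.sqrt b * x + Real.sqrt lo) ^ 3) volume 0 δ := by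
      rw [intervalIntegrable_iff_integrableOn_Icc_of_le hδ.le]
      refine ContinuousOn.integrableOn_compact isCompact_Icc ?_
      refine ContinuousOn.div continuousOn_const ((continuousOn_const.mul continuousOn_id).add continuousOn_const |>.pow 3) fun x hx => ?_
      exact pow_ne_zero 3 (hq x hx.1).ne'
    simp only [hgpre]
    rw [intervalIntegral.integral_add (hi.const_mul A) intervalIntegrable_const, intervalIntegral.integral_const_mul,
      intervalIntegral.integral_const, sub_zero, smul_eq_mul]
    have h1 := intervalIntegral_pre_majorant_le hlo hb hδ.le
    nlinarith [h1, hA, mul_comm δ B]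
  have hpre_pt : ∀ ϑ ∈ Icc (c₁ - δ) (c₂ + δ), ∀ x : ℝ, 0 ≤ x → (ϑ < c₁ ∨ c₂ < ϑ) → b * x ^ 2 ≤ |m ϑ| → F ϑ ≤ gpre x + R ϑ :=
    fun ϑ hϑ x hx hside hbx => by
    have h1 := hpre ϑ hϑ hside
    have h2 := pre_majorant_le hlo hb hx hbx
    simp only [hgpre]
    have := mul_le_mul_of_nonneg_left h2 hA
    linarith
  -- piece 4: `[c₂, c₂ + δ]`
  have hp4 : ∫ ϑ in c₂..(c₂ + δ), F ϑ ≤ A * (4 / Real.sqrt b) + B * δ + ∫ ϑ in c₂..(c₂ + δ), R ϑ := by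
    have hmi : IntervalIntegrable (fun ϑ => gpre (ϑ - c₂)) volume c₂ (c₂ + δ) := by
      have h := (hgpre_int).comp_sub_right c₂
      simp only [zero_add] at h
      rwa [add_comm] at h
    have hle : ∫ ϑ in c₂..(c₂ + δ), F ϑ ≤ ∫ ϑ in c₂..(c₂ + δ), (gpre (ϑ - c₂) + R ϑ) := by
      rw [intervalIntegral.integral_of_le (by linarith), intervalIntegral.integral_of_le (by linarith)]
      refine integral_mono_of_nonneg ?_ (hmi.add hi4.2).1 ?_
      · exact (ae_restrict_iff' measurableSet_Ioc).2 (Filter.Eventually.of_forall fun ϑ hϑ => hF0 ϑ ⟨by linarith [hϑ.1], hϑ.2⟩)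
      · refine (ae_restrict_iff' measurableSet_Ioc).2 (Filter.Eventually.of_forall fun ϑ hϑ => ?_)
        have hx : 0 < ϑ - c₂ := by linarith [hϑ.1]
        have hϑI : ϑ ∈ Icc (c₁ - δ) (c₂ + δ) := ⟨by linarith [hϑ.1], hϑ.2⟩
        refine hpre_pt ϑ hϑI (ϑ - c₂) hx.le (Or.inr hϑ.1) ?_
        have hmm := hm ϑ hϑI
        have h1 : ϑ - c₂ ≤ |ϑ - c₁| := by rw [abs_of_pos (by linarith [hϑ.1])]; linarith
        rw [abs_of_pos hx] at hmm
        calc b * (ϑ - c₂) ^ 2 = b * (ϑ - c₂) * (ϑ - c₂) := by ring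
          _ ≤ b * |ϑ - c₁| * (ϑ - c₂) := by
              exact mul_le_mul_of_nonneg_right (mul_le_mul_of_nonneg_left h1 hb.le) hx.le
          _ ≤ |m ϑ| := hmm
    refine hle.trans ?_
    rw [intervalIntegral.integral_add hmi hi4.2, intervalIntegral.integral_comp_sub_right gpre c₂, sub_self, show c₂ + δ - c₂ = δ by ring]
    linarith [hgpre_val]
  -- piece 1: `[c₁ − δ, c₁]`
  have hp1 : ∫ ϑ in (c₁ - δ)..c₁, F ϑ ≤ A * (4 / Real.sqrt b) + B * δ + ∫ ϑ in (c₁ - δ)..c₁, R ϑ := by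
    have hmi : IntervalIntegrable (fun ϑ => gpre (c₁ - ϑ)) volume (c₁ - δ) c₁ := by
      have h := ((hgpre_int).comp_sub_left c₁).symm
      simpa using h
    have hle : ∫ ϑ in (c₁ - δ)..c₁, F ϑ ≤ ∫ ϑ in (c₁ - δ)..c₁, (gpre (c₁ - ϑ) + R ϑ) := by
      rw [intervalIntegral.integral_of_le (by linarith), intervalIntegral.integral_of_le (by linarith), integral_Ioc_eq_integral_Ioo,
        integral_Ioc_eq_integral_Ioo]
      refine integral_mono_of_nonneg ?_ ((hmi.add hi1.2).1.mono_set Ioo_subset_Ioc_self) ?_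
      · exact (ae_restrict_iff' measurableSet_Ioo).2 (Filter.Eventually.of_forall fun ϑ hϑ => hF0 ϑ ⟨hϑ.1.le, by linarith [hϑ.2]⟩)
      · refine (ae_restrict_iff' measurableSet_Ioo).2 (Filter.Eventually.of_forall fun ϑ hϑ => ?_)
        have hx : 0 < c₁ - ϑ := by linarith [hϑ.2]
        have hϑI : ϑ ∈ Icc (c₁ - δ) (c₂ + δ) := ⟨hϑ.1.le, by linarith [hϑ.2]⟩
        refine hpre_pt ϑ hϑI (c₁ - ϑ) hx.le (Or.inl hϑ.2) ?_
        have hmm := hm ϑ hϑI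
        have h1 : c₁ - ϑ ≤ |ϑ - c₂| := by rw [abs_of_neg (by linarith [hϑ.2])]; linarith
        rw [abs_of_neg (by linarith [hϑ.2] : ϑ - c₁ < 0), neg_sub] at hmm
        calc b * (c₁ - ϑ) ^ 2 = b * (c₁ - ϑ) * (c₁ - ϑ) := by ring
          _ ≤ b * (c₁ - ϑ) * |ϑ - c₂| := by
              exact mul_le_mul_of_nonneg_left h1 (by positivity)
          _ ≤ |m ϑ| := hmm
    refine hle.trans ?_
    rw [intervalIntegral.integral_add hmi hi1.2, intervalIntegral.integral_comp_sub_left gpre c₁, sub_self, show c₁ - (c₁ - δ) = δ by ring]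
    linarith [hgpre_val]
  -- the two inner halves
  have hinner : (∫ ϑ in c₁..mid, F ϑ) + ∫ ϑ in mid..c₂, F ϑ ≤
      P * (4 / Real.sqrt b) + B * (c₂ - c₁) + ((∫ ϑ in c₁..mid, R ϑ) + ∫ ϑ in mid..c₂, R ϑ) := by
    rcases eq_or_lt_of_le hh0 with hz | hpos
    · have hc0 : c₂ = c₁ := by
        have h2 : (c₂ - c₁) / 2 = 0 := by rw [← hh]; exact hz.symm
        linarith
      have hm0 : mid = c₁ := by rw [hmid, ← hz, add_zero]
      rw [hm0, hc0]
      simp only [intervalIntegral.integral_same, sub_self, mul_zero, add_zero]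
      positivity
    · set gpost : ℝ → ℝ := fun x => P * ((Real.sqrt (b * h))⁻¹ * x ^ (-(1 / 2) : ℝ)) + B with hgpost
      have hgpost_int : ∀ p q : ℝ, IntervalIntegrable gpost volume p q := fun p q =>
        ((intervalIntegral.intervalIntegrable_rpow' (by norm_num)).const_mul _ |>.const_mul P).add intervalIntegrable_const
      have hgpost_val : ∫ x in (0 : ℝ)..h, gpost x = P * (2 / Real.sqrt b) + B * h := by
        simp only [hgpost]
        rw [intervalIntegral.integral_add (((intervalIntegral.intervalIntegrable_rpow' (by norm_num)).const_mul _).const_mul P)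
          intervalIntegrable_const, intervalIntegral.integral_const_mul, intervalIntegral_post_majorant hb hpos, intervalIntegral.integral_const,
          sub_zero, smul_eq_mul, mul_comm h B]
      have hpost_pt : ∀ ϑ ∈ Ioo c₁ c₂, ∀ x : ℝ, 0 < x → b * h * x ≤ |m ϑ| → F ϑ ≤ gpost x + R ϑ := fun ϑ hϑ x hx hbx => by
        have h1 := hpost ϑ hϑ
        have h2 := post_majorant_le hb hpos hx hbx
        simp only [hgpost]
        have := mul_le_mul_of_nonneg_left h2 hP
        linarith
      have hL : ∫ ϑ in c₁..mid, F ϑ ≤ P * (2 / Real.sqrt b) + B * h + ∫ ϑ in c₁..mid, R ϑ := by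
        have hmi : IntervalIntegrable (fun ϑ => gpost (ϑ - c₁)) volume c₁ mid := by
          have h := (hgpost_int (c₁ - c₁) (mid - c₁)).comp_sub_right c₁
          simp only [sub_add_cancel, sub_self, zero_add] at h
          exact h
        have hle : ∫ ϑ in c₁..mid, F ϑ ≤ ∫ ϑ in c₁..mid, (gpost (ϑ - c₁) + R ϑ) := by
          rw [intervalIntegral.integral_of_le (by rw [hmid]; linarith), intervalIntegral.integral_of_le (by rw [hmid]; linarith)]
          refine integral_mono_of_nonneg ?_ (hmi.add hi2.2).1 ?_
          · exact (ae_restrict_iff' measurableSet_Ioc).2 (Filter.Eventually.of_forall fun ϑ hϑ =>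
              hF0 ϑ ⟨by linarith [hϑ.1], by rw [hmid'] at hϑ; linarith [hϑ.2]⟩)
          · refine (ae_restrict_iff' measurableSet_Ioc).2 (Filter.Eventually.of_forall fun ϑ hϑ => ?_)
            have hx : 0 < ϑ - c₁ := by linarith [hϑ.1]
            have h2ϑ : h ≤ c₂ - ϑ := by rw [hmid'] at hϑ; linarith [hϑ.2]
            have hϑ2 : ϑ < c₂ := by linarith
            refine hpost_pt ϑ ⟨hϑ.1, hϑ2⟩ (ϑ - c₁) hx ?_
            have hmm := hm ϑ ⟨by linarith, by linarith⟩
            rw [abs_of_pos hx, abs_of_neg (by linarith : ϑ - c₂ < 0), neg_sub] at hmm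
            calc b * h * (ϑ - c₁) = b * (ϑ - c₁) * h := by ring
              _ ≤ b * (ϑ - c₁) * (c₂ - ϑ) := mul_le_mul_of_nonneg_left h2ϑ (by positivity)
              _ ≤ |m ϑ| := hmm
        refine hle.trans ?_
        rw [intervalIntegral.integral_add hmi hi2.2, intervalIntegral.integral_comp_sub_right gpost c₁, sub_self,
          show mid - c₁ = h by rw [hmid]; ring, hgpost_val]
      have hR : ∫ ϑ in mid..c₂, F ϑ ≤ P * (2 / Real.sqrt b) + B * h + ∫ ϑ in mid..c₂, R ϑ := by
        have hmi : IntervalIntegrable (fun ϑ => gpost (c₂ - ϑ)) volume mid c₂ := by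
          have h := (hgpost_int (c₂ - mid) (c₂ - c₂)).comp_sub_left c₂
          simpa using h
        have hle : ∫ ϑ in mid..c₂, F ϑ ≤ ∫ ϑ in mid..c₂, (gpost (c₂ - ϑ) + R ϑ) := by
          rw [intervalIntegral.integral_of_le (by rw [hmid']; linarith), intervalIntegral.integral_of_le (by rw [hmid']; linarith),
            integral_Ioc_eq_integral_Ioo, integral_Ioc_eq_integral_Ioo]
          refine integral_mono_of_nonneg ?_ ((hmi.add hi3.2).1.mono_set Ioo_subset_Ioc_self) ?_
          · exact (ae_restrict_iff' measurableSet_Ioo).2 (Filter.Eventually.of_forall fun ϑ hϑ =>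
              hF0 ϑ ⟨by rw [hmid] at hϑ; linarith [hϑ.1], by linarith [hϑ.2]⟩)
          · refine (ae_restrict_iff' measurableSet_Ioo).2 (Filter.Eventually.of_forall fun ϑ hϑ => ?_)
            have hx : 0 < c₂ - ϑ := by linarith [hϑ.2]
            have h1ϑ : h ≤ ϑ - c₁ := by rw [hmid] at hϑ; linarith [hϑ.1]
            have hϑ1 : c₁ < ϑ := by linarith
            refine hpost_pt ϑ ⟨hϑ1, hϑ.2⟩ (c₂ - ϑ) hx ?_
            have hmm := hm ϑ ⟨by linarith, by linarith⟩
            rw [abs_of_pos (by linarith : 0 < ϑ - c₁), abs_of_neg (by linarith : ϑ - c₂ < 0), neg_sub] at hmm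
            calc b * h * (c₂ - ϑ) ≤ b * (ϑ - c₁) * (c₂ - ϑ) :=
                  mul_le_mul_of_nonneg_right (mul_le_mul_of_nonneg_left h1ϑ hb.le) hx.le
              _ ≤ |m ϑ| := hmm
        refine hle.trans ?_
        rw [intervalIntegral.integral_add hmi hi3.2, intervalIntegral.integral_comp_sub_left gpost c₂, sub_self,
          show c₂ - mid = h by rw [hmid']; ring, hgpost_val]
      have hh2 : B * (c₂ - c₁) = 2 * (B * h) := by rw [hh]; ring
      have hP2 : P * (4 / Real.sqrt b) = 2 * (P * (2 / Real.sqrt b)) := by ring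
      rw [hh2, hP2]
      linarith [hL, hR]
  have htot : (8 * A + 4 * P) / Real.sqrt b + B * (2 * δ + (c₂ - c₁)) =
      (A * (4 / Real.sqrt b) + B * δ) + ((P * (4 / Real.sqrt b) + B * (c₂ - c₁)) + (A * (4 / Real.sqrt b) + B * δ)) := by
    field_simp; ring
  rw [htot]
  linarith [hp1, hp4, hinner]

/-! ## §2 The logarithmic remainder majorised by two inverse square roots -/

/-- **THE LOGARITHMIC REMAINDER IN PRODUCT-FORM CURRENCY**: `0 < b`, `ϑ ∉ {c₁, c₂}`, `b|ϑ − c₁||ϑ − c₂| ≤ |m| ≤ Γ` ⟹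
`log(Γ/|m|) ≤ 2·(Γ/b)^{1/4}·(|ϑ − c₁|^{−1/2} + |ϑ − c₂|^{−1/2})` — two inverse square roots, each integrable across its zero uniformly in the gap. -/
theorem log_offset_le_rpow_sum {b Γ m ϑ c₁ c₂ : ℝ} (hb : 0 < b) (h₁ : ϑ ≠ c₁) (h₂ : ϑ ≠ c₂) (hm : b * |ϑ - c₁| * |ϑ - c₂| ≤ |m|) (hmΓ : |m| ≤ Γ) :
    Real.log (Γ / |m|) ≤ 2 * (Γ / b) ^ (1 / 4 : ℝ) * (|ϑ - c₁| ^ (-(1 / 2) : ℝ) + |ϑ - c₂| ^ (-(1 / 2) : ℝ)) := by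
  have hd₁ : 0 < |ϑ - c₁| := abs_pos.2 (sub_ne_zero.2 h₁)
  have hd₂ : 0 < |ϑ - c₂| := abs_pos.2 (sub_ne_zero.2 h₂)
  have hprod : 0 < b * |ϑ - c₁| * |ϑ - c₂| := by positivity
  have hmpos : 0 < |m| := lt_of_lt_of_le hprod hm
  have hΓ : 0 < Γ := lt_of_lt_of_le hmpos hmΓ
  -- `log(Γ/|m|) ≤ 4 (Γ/|m|)^{1/4} ≤ 4 (Γ/(b d₁ d₂))^{1/4}`
  have h1 : Real.log (Γ / |m|) ≤ 4 * (Γ / |m|) ^ (1 / 4 : ℝ) := by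
    have h := Real.log_le_rpow_div (show (0 : ℝ) ≤ Γ / |m| by positivity) (by norm_num : (0 : ℝ) < 1 / 4)
    linarith [h, show (Γ / |m|) ^ (1 / 4 : ℝ) / (1 / 4) = 4 * (Γ / |m|) ^ (1 / 4 : ℝ) by ring]
  have h2 : (Γ / |m|) ^ (1 / 4 : ℝ) ≤ (Γ / (b * |ϑ - c₁| * |ϑ - c₂|)) ^ (1 / 4 : ℝ) :=
    Real.rpow_le_rpow (by positivity) (div_le_div_of_nonneg_left hΓ.le hprod hm) (by norm_num)
  -- `(Γ/(b d₁ d₂))^{1/4} = (Γ/b)^{1/4} · (d₁^{-1/2} d₂^{-1/2})^{1/2} ≤ (Γ/b)^{1/4} · (d₁^{-1/2} + d₂^{-1/2})/2`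
  have hsplit : (Γ / (b * |ϑ - c₁| * |ϑ - c₂|)) ^ (1 / 4 : ℝ) =
      (Γ / b) ^ (1 / 4 : ℝ) * (|ϑ - c₁| ^ (-(1 / 4) : ℝ) * |ϑ - c₂| ^ (-(1 / 4) : ℝ)) := by
    rw [show Γ / (b * |ϑ - c₁| * |ϑ - c₂|) = (Γ / b) * ((|ϑ - c₁|)⁻¹ * (|ϑ - c₂|)⁻¹) by field_simp,
      Real.mul_rpow (by positivity) (by positivity), Real.mul_rpow (by positivity) (by positivity),
      Real.inv_rpow hd₁.le, Real.inv_rpow hd₂.le, ← Real.rpow_neg hd₁.le, ← Real.rpow_neg hd₂.le]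
  have hamgm : |ϑ - c₁| ^ (-(1 / 4) : ℝ) * |ϑ - c₂| ^ (-(1 / 4) : ℝ) ≤ (|ϑ - c₁| ^ (-(1 / 2) : ℝ) + |ϑ - c₂| ^ (-(1 / 2) : ℝ)) / 2 := by
    have hu : |ϑ - c₁| ^ (-(1 / 2) : ℝ) = (|ϑ - c₁| ^ (-(1 / 4) : ℝ)) ^ 2 := by
      rw [← Real.rpow_natCast, ← Real.rpow_mul hd₁.le]; norm_num
    have hv : |ϑ - c₂| ^ (-(1 / 2) : ℝ) = (|ϑ - c₂| ^ (-(1 / 4) : ℝ)) ^ 2 := by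
      rw [← Real.rpow_natCast, ← Real.rpow_mul hd₂.le]; norm_num
    rw [hu, hv]
    nlinarith [sq_nonneg (|ϑ - c₁| ^ (-(1 / 4) : ℝ) - |ϑ - c₂| ^ (-(1 / 4) : ℝ))]
  have hΓb : 0 ≤ (Γ / b) ^ (1 / 4 : ℝ) := by positivity
  calc Real.log (Γ / |m|) ≤ 4 * (Γ / (b * |ϑ - c₁| * |ϑ - c₂|)) ^ (1 / 4 : ℝ) := h1.trans (by linarith [h2])
    _ = 4 * ((Γ / b) ^ (1 / 4 : ℝ) * (|ϑ - c₁| ^ (-(1 / 4) : ℝ) * |ϑ - c₂| ^ (-(1 / 4) : ℝ))) := by rw [hsplit]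
    _ ≤ 4 * ((Γ / b) ^ (1 / 4 : ℝ) * ((|ϑ - c₁| ^ (-(1 / 2) : ℝ) + |ϑ - c₂| ^ (-(1 / 2) : ℝ)) / 2)) := by
        have := mul_le_mul_of_nonneg_left hamgm hΓb
        linarith
    _ = 2 * (Γ / b) ^ (1 / 4 : ℝ) * (|ϑ - c₁| ^ (-(1 / 2) : ℝ) + |ϑ - c₂| ^ (-(1 / 2) : ℝ)) := by ring

/-- **An inverse square root integrates across its zero**: for `p ≤ c ≤ q`, `∫_p^q |ϑ − c|^{−1/2} dϑ ≤ 4√(q − p)` (`= 2√(c − p) + 2√(q − c)`). -/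
theorem intervalIntegral_abs_sub_rpow_neg_half_le {p q c : ℝ} (hpc : p ≤ c) (hcq : c ≤ q) :
    ∫ ϑ in p..q, |ϑ - c| ^ (-(1 / 2) : ℝ) ≤ 4 * Real.sqrt (q - p) := by
  have hr : (-1 : ℝ) < -(1 / 2) := by norm_num
  -- right piece `[c, q]`: `|ϑ − c| = ϑ − c`
  have hR_int : IntervalIntegrable (fun ϑ : ℝ => (ϑ - c) ^ (-(1 / 2) : ℝ)) volume c q := by
    have h := (intervalIntegral.intervalIntegrable_rpow' hr (a := c - c) (b := q - c)).comp_sub_right c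
    simp only [sub_add_cancel, sub_self, zero_add] at h
    exact h
  have hR_eq : ∫ ϑ in c..q, |ϑ - c| ^ (-(1 / 2) : ℝ) = ∫ ϑ in c..q, (ϑ - c) ^ (-(1 / 2) : ℝ) := by
    refine intervalIntegral.integral_congr fun ϑ hϑ => ?_
    rw [uIcc_of_le hcq] at hϑ
    simp only [abs_of_nonneg (sub_nonneg.2 hϑ.1)]
  have hR_val : ∫ ϑ in c..q, (ϑ - c) ^ (-(1 / 2) : ℝ) = 2 * Real.sqrt (q - c) := by
    rw [intervalIntegral.integral_comp_sub_right (fun x : ℝ => x ^ (-(1 / 2) : ℝ)) c, sub_self, integral_rpow (Or.inl hr)]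
    have h1 : (-(1 / 2) : ℝ) + 1 = 1 / 2 := by norm_num
    rw [h1, Real.zero_rpow (by norm_num : (1 / 2 : ℝ) ≠ 0), sub_zero, ← Real.sqrt_eq_rpow]
    ring
  -- left piece `[p, c]`: `|ϑ − c| = c − ϑ`
  have hL_int : IntervalIntegrable (fun ϑ : ℝ => (c - ϑ) ^ (-(1 / 2) : ℝ)) volume p c := by
    have h := ((intervalIntegral.intervalIntegrable_rpow' hr (a := c - c) (b := c - p)).comp_sub_left c).symm
    simp only [sub_sub_cancel, sub_self, sub_zero] at h
    exact h
  have hL_eq : ∫ ϑ in p..c, |ϑ - c| ^ (-(1 / 2) : ℝ) = ∫ ϑ in p..c, (c - ϑ) ^ (-(1 / 2) : ℝ) := by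
    refine intervalIntegral.integral_congr fun ϑ hϑ => ?_
    rw [uIcc_of_le hpc] at hϑ
    simp only [abs_of_nonpos (sub_nonpos.2 hϑ.2), neg_sub]
  have hL_val : ∫ ϑ in p..c, (c - ϑ) ^ (-(1 / 2) : ℝ) = 2 * Real.sqrt (c - p) := by
    rw [intervalIntegral.integral_comp_sub_left (fun x : ℝ => x ^ (-(1 / 2) : ℝ)) c, sub_self, integral_rpow (Or.inl hr)]
    have h1 : (-(1 / 2) : ℝ) + 1 = 1 / 2 := by norm_num
    rw [h1, Real.zero_rpow (by norm_num : (1 / 2 : ℝ) ≠ 0), sub_zero, ← Real.sqrt_eq_rpow]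
    ring
  -- integrability of the absolute-value form on both pieces (congruence on the closed intervals)
  have hR_int' : IntervalIntegrable (fun ϑ : ℝ => |ϑ - c| ^ (-(1 / 2) : ℝ)) volume c q := by
    refine hR_int.congr ?_
    rw [uIoc_of_le hcq]
    intro ϑ hϑ
    simp only [abs_of_nonneg (sub_nonneg.2 hϑ.1.le)]
  have hL_int' : IntervalIntegrable (fun ϑ : ℝ => |ϑ - c| ^ (-(1 / 2) : ℝ)) volume p c := by
    refine hL_int.congr ?_
    rw [uIoc_of_le hpc]
    intro ϑ hϑ
    simp only [abs_of_nonpos (sub_nonpos.2 hϑ.2), neg_sub]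
  rw [← integral_add_adjacent_intervals hL_int' hR_int', hL_eq, hR_eq, hL_val, hR_val]
  have h1 : Real.sqrt (c - p) ≤ Real.sqrt (q - p) := Real.sqrt_le_sqrt (by linarith)
  have h2 : Real.sqrt (q - c) ≤ Real.sqrt (q - p) := Real.sqrt_le_sqrt (by linarith)
  linarith

/-- **THE EXPLICIT REMAINDER MAJORANT AND ITS INTEGRAL**: on the window `[c₁ − δ, c₂ + δ]` (`c₁ ≤ c₂`, `0 ≤ δ`) the function
`R(ϑ) = B′·2(Γ/b)^{1/4}·(|ϑ − c₁|^{−1/2} + |ϑ − c₂|^{−1/2})` (`B′ ≥ 0`) is interval-integrable, nonnegative, and `∫ R ≤ B′·2(Γ/b)^{1/4}·8√(c₂ − c₁ + 2δ)` — the `(hR0, hRi)`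
input of `intervalIntegral_caustic_pair_remainder_le` for the logarithmic remainder of the pre-caustic angle layer (via `log_offset_le_rpow_sum`). -/
theorem intervalIntegral_log_remainder_majorant_le {c₁ c₂ δ b Γ B' : ℝ} (hc : c₁ ≤ c₂) (hδ : 0 ≤ δ) (hb : 0 < b) (hΓ : 0 ≤ Γ) (hB' : 0 ≤ B') :
    IntervalIntegrable (fun ϑ : ℝ => B' * (2 * (Γ / b) ^ (1 / 4 : ℝ) * (|ϑ - c₁| ^ (-(1 / 2) : ℝ) + |ϑ - c₂| ^ (-(1 / 2) : ℝ)))) volume (c₁ - δ) (c₂ + δ) ∧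
      (∀ ϑ : ℝ, 0 ≤ B' * (2 * (Γ / b) ^ (1 / 4 : ℝ) * (|ϑ - c₁| ^ (-(1 / 2) : ℝ) + |ϑ - c₂| ^ (-(1 / 2) : ℝ)))) ∧
      ∫ ϑ in (c₁ - δ)..(c₂ + δ), B' * (2 * (Γ / b) ^ (1 / 4 : ℝ) * (|ϑ - c₁| ^ (-(1 / 2) : ℝ) + |ϑ - c₂| ^ (-(1 / 2) : ℝ))) ≤
        B' * (2 * (Γ / b) ^ (1 / 4 : ℝ)) * (8 * Real.sqrt (c₂ - c₁ + 2 * δ)) := by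
  have hr : (-1 : ℝ) < -(1 / 2) := by norm_num
  -- integrability of `|ϑ − c|^{−1/2}` on any interval: from the real power on shifted intervals, by congruence
  have hint : ∀ c p q : ℝ, p ≤ q → IntervalIntegrable (fun ϑ : ℝ => |ϑ - c| ^ (-(1 / 2) : ℝ)) volume p q := by
    intro c p q hpq
    -- `|x|^r` is `x^r` composed with `|·|`; use the two one-sided congruences on `[p, max p (min c q)]`-free route: dominate? Simplest: split cases on the position of `c`.
    have key : ∀ p' q' : ℝ, p' ≤ q' → q' ≤ c → IntervalIntegrable (fun ϑ : ℝ => |ϑ - c| ^ (-(1 / 2) : ℝ)) volume p' q' := by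
      intro p' q' hp'q' hq'c
      have h := ((intervalIntegral.intervalIntegrable_rpow' hr (a := c - q') (b := c - p')).comp_sub_left c)
      simp only [sub_sub_cancel] at h
      refine (h.symm).congr ?_
      rw [uIoc_of_le hp'q']
      intro ϑ hϑ
      simp only [abs_of_nonpos (show ϑ - c ≤ 0 by linarith [hϑ.2]), neg_sub]
    have key' : ∀ p' q' : ℝ, p' ≤ q' → c ≤ p' → IntervalIntegrable (fun ϑ : ℝ => |ϑ - c| ^ (-(1 / 2) : ℝ)) volume p' q' := by
      intro p' q' hp'q' hcp'
      have h := ((intervalIntegral.intervalIntegrable_rpow' hr (a := p' - c) (b := q' - c)).comp_sub_right c)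
      simp only [sub_add_cancel] at h
      refine h.congr ?_
      rw [uIoc_of_le hp'q']
      intro ϑ hϑ
      simp only [abs_of_nonneg (show 0 ≤ ϑ - c by linarith [hϑ.1])]
    rcases le_total c p with hcp | hpc
    · exact key' p q hpq hcp
    rcases le_total q c with hqc | hcq
    · exact key p q hpq hqc
    · exact (key p c hpc le_rfl).trans (key' c q hcq le_rfl)
  have hw : c₁ - δ ≤ c₂ + δ := by linarith
  have hi₁ := hint c₁ (c₁ - δ) (c₂ + δ) hw
  have hi₂ := hint c₂ (c₁ - δ) (c₂ + δ) hw
  refine ⟨((hi₁.add hi₂).const_mul _).const_mul B', fun ϑ => ?_, ?_⟩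
  · have : 0 ≤ |ϑ - c₁| ^ (-(1 / 2) : ℝ) := Real.rpow_nonneg (abs_nonneg _) _
    have : 0 ≤ |ϑ - c₂| ^ (-(1 / 2) : ℝ) := Real.rpow_nonneg (abs_nonneg _) _
    positivity
  · rw [intervalIntegral.integral_const_mul, intervalIntegral.integral_const_mul, intervalIntegral.integral_add hi₁ hi₂]
    have h1 := intervalIntegral_abs_sub_rpow_neg_half_le (p := c₁ - δ) (q := c₂ + δ) (c := c₁) (by linarith) (by linarith)
    have h2 := intervalIntegral_abs_sub_rpow_neg_half_le (p := c₁ - δ) (q := c₂ + δ) (c := c₂) (by linarith) (by linarith)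
    have hlen : c₂ + δ - (c₁ - δ) = c₂ - c₁ + 2 * δ := by ring
    rw [hlen] at h1 h2
    have hcoef : 0 ≤ B' * (2 * (Γ / b) ^ (1 / 4 : ℝ)) := by positivity
    calc B' * (2 * (Γ / b) ^ (1 / 4 : ℝ) * ((∫ ϑ in (c₁ - δ)..(c₂ + δ), |ϑ - c₁| ^ (-(1 / 2) : ℝ)) + ∫ ϑ in (c₁ - δ)..(c₂ + δ), |ϑ - c₂| ^ (-(1 / 2) : ℝ)))
        = B' * (2 * (Γ / b) ^ (1 / 4 : ℝ)) * ((∫ ϑ in (c₁ - δ)..(c₂ + δ), |ϑ - c₁| ^ (-(1 / 2) : ℝ)) + ∫ ϑ in (c₁ - δ)..(c₂ + δ), |ϑ - c₂| ^ (-(1 / 2) : ℝ)) := by ring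
      _ ≤ B' * (2 * (Γ / b) ^ (1 / 4 : ℝ)) * (8 * Real.sqrt (c₂ - c₁ + 2 * δ)) := by
          refine mul_le_mul_of_nonneg_left ?_ hcoef
          linarith

/-- **THE `log²` REMAINDER IN PRODUCT-FORM CURRENCY** (§3, appended): `b|ϑ − c₁||ϑ − c₂| ≤ |m| ≤ Γ` off the zeros ⟹ `(1 + log⁺(Γ/|m|))² ≤
81·(Γ/b)^{1/4}·(|ϑ − c₁|^{−1/2} + |ϑ − c₂|^{−1/2})/2` — the `B·(1 + log)²` line of `…C4aFoldLevelLayer` rides in the remainder `R` of §1 with §2's majorant. -/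
theorem sq_one_add_posLog_offset_le_rpow_sum {b Γ m ϑ c₁ c₂ : ℝ} (hb : 0 < b) (h₁ : ϑ ≠ c₁) (h₂ : ϑ ≠ c₂) (hm : b * |ϑ - c₁| * |ϑ - c₂| ≤ |m|)
    (hmΓ : |m| ≤ Γ) :
    (1 + log⁺ (Γ / |m|)) ^ 2 ≤ 81 * (Γ / b) ^ (1 / 4 : ℝ) * ((|ϑ - c₁| ^ (-(1 / 2) : ℝ) + |ϑ - c₂| ^ (-(1 / 2) : ℝ)) / 2) := by
  have hd₁ : 0 < |ϑ - c₁| := abs_pos.2 (sub_ne_zero.2 h₁); have hd₂ : 0 < |ϑ - c₂| := abs_pos.2 (sub_ne_zero.2 h₂)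
  have hprod : 0 < b * |ϑ - c₁| * |ϑ - c₂| := by positivity
  have hmpos : 0 < |m| := lt_of_lt_of_le hprod hm; have hΓ : 0 < Γ := lt_of_lt_of_le hmpos hmΓ
  have h1 : (1 + log⁺ (Γ / |m|)) ^ 2 ≤ 81 * (Γ / |m|) ^ (1 / 4 : ℝ) := one_add_posLog_sq_le hmpos hmΓ
  have h2 : (Γ / |m|) ^ (1 / 4 : ℝ) ≤ (Γ / (b * |ϑ - c₁| * |ϑ - c₂|)) ^ (1 / 4 : ℝ) :=
    Real.rpow_le_rpow (by positivity) (div_le_div_of_nonneg_left hΓ.le hprod hm) (by norm_num)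
  have hsplit : (Γ / (b * |ϑ - c₁| * |ϑ - c₂|)) ^ (1 / 4 : ℝ) =
      (Γ / b) ^ (1 / 4 : ℝ) * (|ϑ - c₁| ^ (-(1 / 4) : ℝ) * |ϑ - c₂| ^ (-(1 / 4) : ℝ)) := by
    rw [show Γ / (b * |ϑ - c₁| * |ϑ - c₂|) = (Γ / b) * ((|ϑ - c₁|)⁻¹ * (|ϑ - c₂|)⁻¹) by field_simp,
      Real.mul_rpow (by positivity) (by positivity), Real.mul_rpow (by positivity) (by positivity),
      Real.inv_rpow hd₁.le, Real.inv_rpow hd₂.le, ← Real.rpow_neg hd₁.le, ← Real.rpow_neg hd₂.le]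
  have hamgm : |ϑ - c₁| ^ (-(1 / 4) : ℝ) * |ϑ - c₂| ^ (-(1 / 4) : ℝ) ≤ (|ϑ - c₁| ^ (-(1 / 2) : ℝ) + |ϑ - c₂| ^ (-(1 / 2) : ℝ)) / 2 := by
    have hu : |ϑ - c₁| ^ (-(1 / 2) : ℝ) = (|ϑ - c₁| ^ (-(1 / 4) : ℝ)) ^ 2 := by
      rw [← Real.rpow_natCast, ← Real.rpow_mul hd₁.le]; norm_num
    have hv : |ϑ - c₂| ^ (-(1 / 2) : ℝ) = (|ϑ - c₂| ^ (-(1 / 4) : ℝ)) ^ 2 := by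
      rw [← Real.rpow_natCast, ← Real.rpow_mul hd₂.le]; norm_num
    rw [hu, hv]
    nlinarith [sq_nonneg (|ϑ - c₁| ^ (-(1 / 4) : ℝ) - |ϑ - c₂| ^ (-(1 / 4) : ℝ))]
  have hΓb : 0 ≤ 81 * (Γ / b) ^ (1 / 4 : ℝ) := by positivity
  calc (1 + log⁺ (Γ / |m|)) ^ 2 ≤ 81 * (Γ / (b * |ϑ - c₁| * |ϑ - c₂|)) ^ (1 / 4 : ℝ) := h1.trans (by linarith [h2])
    _ = 81 * (Γ / b) ^ (1 / 4 : ℝ) * (|ϑ - c₁| ^ (-(1 / 4) : ℝ) * |ϑ - c₂| ^ (-(1 / 4) : ℝ)) := by rw [hsplit]; ring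
    _ ≤ 81 * (Γ / b) ^ (1 / 4 : ℝ) * ((|ϑ - c₁| ^ (-(1 / 2) : ℝ) + |ϑ - c₂| ^ (-(1 / 2) : ℝ)) / 2) :=
        mul_le_mul_of_nonneg_left hamgm hΓb

end Summit.HubbardSuperconductivity.HubbardSuperconductivity.Theorems.C4a

end
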